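import Summits.Ventures.HodgeRepro2.T6A2Model

/-!
# T6A2Theta — sub-claim A2 on the explicit model: the vertex subspaces `H¹(A_i, ℚ) ⊂ H²(A_i, ℚ) ⊂ H^*(B, ℚ)`,
their complexification and the plane generators `E_{g,g'} = ι(e_g) ∧ ι(e_{g'})`

Cell pub-hodge-repro2, Tier 6 (README §10), seat t6-p2 (A2 owner). Layer II over `T6Interface` v0 through
`T6A2Model`. Definition lane: `gen1`, `vertexH1`, `vertexH2`, `gen1C`, `gen1CL`, `LiC`, `PiC`, `planeGen`.

* `vertexH1 K i = ι(single i K)`, `vertexH2 K i = vertexH1 * vertexH1` — `H¹(A_i, ℚ)` and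
  `H²(A_i, ℚ) = ∧² H¹(A_i, ℚ)` inside `HB K` (TIER4 A4.2: `X = A_i`); `vertexH2_le_degB` (⊂ `H²(B, ℚ)`);
  `pullEndo_vertexH2_le`, `aeval_pullEndo_mem_vertexH2` — `[x]^*` and every polynomial in it preserve
  `H²(A_i, ℚ)` (Lemma A4.2.2: `p_2 = P_2(ι_i(x)^*)` acts on `H²(X, ℚ)`).
* `gen1C K i w = ι(single i w)`, `w ∈ K ⊗ ℂ`; `extC_gen1` — the complexification of a vertex generator;
  `single_mem_eigenLine`.
* For a family `e` of vectors of `K ⊗ ℂ` (the eigenline generators of A1): `LiC` (their ℂ-span at vertex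
  `i`), `PiC = LiC * LiC`, `planeGen K e i (g, g') = ι(single i (e g)) ∧ ι(single i (e g'))` (TIER4 A0.6:
  `ℓ_{i,σ} ∧ ℓ_{i,σ'}`); `gen1C_mem_LiC`, `extC_mem_PiC`, `PiC_eq_span`, `exists_coeffs` — when `e` spans
  `K ⊗ ℂ`, every complexified rational class of `H²(A_i)` is a ℂ-combination of the plane generators
  (the expansion `extC θ₀ = Σ a_{g,g'} E_{g,g'}` behind (A4.2.7)).

No `sorry`; standard axioms.
-/
namespace Summit.Ventures.HodgeRepro2.T6.A2Theta

open Summit.Ventures.HodgeRepro2.T6 Summit.Ventures.HodgeRepro2.T6.A2Model Polynomial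

variable (K : Type*) [Field K] [NumberField K]

/-- `ι(single i a)`: the generator of `H¹(A_i, ℚ) ⊂ H^*(B, ℚ)` attached to `a ∈ K` (vertex `i`). -/
noncomputable def gen1 (i : Fin 4) (a : K) : HB K :=
  ExteriorAlgebra.ι ℚ (LinearMap.single ℚ (fun _ => K) i a)

/-- `H¹(A_i, ℚ) ⊂ H^*(B, ℚ)`, the `i`-th vertex line of `H¹(B, ℚ) = K⁴` through `ι`. -/
noncomputable def vertexH1 (i : Fin 4) : Submodule ℚ (HB K) :=
  LinearMap.range ((ExteriorAlgebra.ι ℚ) ∘ₗ LinearMap.single ℚ (fun _ => K) i)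

/-- `H²(A_i, ℚ) = ⋀² H¹(A_i, ℚ) ⊂ H^*(B, ℚ)`: the span of the products `ι(single i a) * ι(single i b)`
(TIER4 A4.2: `X = A_i`, `H²(X, ℚ) = ∧² H¹(X, ℚ)`). -/
noncomputable def vertexH2 (i : Fin 4) : Submodule ℚ (HB K) := vertexH1 K i * vertexH1 K i

/-- `ι(single i a) ∈ H¹(A_i, ℚ)`. -/
theorem gen1_mem_vertexH1 (i : Fin 4) (a : K) : gen1 K i a ∈ vertexH1 K i := ⟨a, rfl⟩

/-- `ι(single i a) * ι(single i b) ∈ H²(A_i, ℚ)`. -/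
theorem gen1_mul_gen1_mem_vertexH2 (i : Fin 4) (a b : K) :
    gen1 K i a * gen1 K i b ∈ vertexH2 K i :=
  Submodule.mul_mem_mul (gen1_mem_vertexH1 K i a) (gen1_mem_vertexH1 K i b)

/-- `ι u * ι v ∈ ⋀² H¹(B, ℚ) = H²(B, ℚ)`. -/
theorem ι_mul_ι_mem_degB_two (u v : H1 K) :
    ExteriorAlgebra.ι ℚ u * ExteriorAlgebra.ι ℚ v ∈ degB K 2 := by
  show _ ∈ LinearMap.range (ExteriorAlgebra.ι ℚ) ^ 2
  rw [pow_two]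
  exact Submodule.mul_mem_mul ⟨u, rfl⟩ ⟨v, rfl⟩

/-- `H²(A_i, ℚ) ⊂ H²(B, ℚ)`. -/
theorem vertexH2_le_degB (i : Fin 4) : vertexH2 K i ≤ degB K 2 := by
  rw [vertexH2, Submodule.mul_le]
  rintro _ ⟨a, rfl⟩ _ ⟨b, rfl⟩
  exact ι_mul_ι_mem_degB_two K _ _

/-- `[x]^*` preserves `H¹(A_i, ℚ)`. -/
theorem pullEndo_vertexH1_le (x : K) (i : Fin 4) :
    (vertexH1 K i).map (pullEndo K x).toLinearMap ≤ vertexH1 K i := by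
  rintro _ ⟨_, ⟨a, rfl⟩, rfl⟩
  refine ⟨x * a, ?_⟩
  simp only [LinearMap.comp_apply, AlgHom.toLinearMap_apply]
  rw [pullEndo_ι]
  congr 1
  ext j
  simp [actH1, LinearMap.single_apply, Pi.single_apply]

/-- `[x]^*` preserves `H²(A_i, ℚ)` (TIER4 A4.2.2: `ι_i(x)^*` acts on `H²(X, ℚ)`). -/
theorem pullEndo_vertexH2_le (x : K) (i : Fin 4) :
    (vertexH2 K i).map (pullEndo K x).toLinearMap ≤ vertexH2 K i := by
  rw [vertexH2, Submodule.map_mul]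
  exact mul_le_mul' (pullEndo_vertexH1_le K x i) (pullEndo_vertexH1_le K x i)

/-- `[x]^*` maps `H²(A_i, ℚ)` into itself (elementwise form). -/
theorem pullEndo_mem_vertexH2 (x : K) (i : Fin 4) {θ : HB K} (hθ : θ ∈ vertexH2 K i) :
    pullEndo K x θ ∈ vertexH2 K i :=
  pullEndo_vertexH2_le K x i ⟨θ, hθ, rfl⟩

/-- A polynomial in `[x]^*` preserves `H²(A_i, ℚ)`. -/
theorem aeval_pullEndo_mem_vertexH2 (x : K) (i : Fin 4) (Q : ℚ[X]) {θ : HB K}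
    (hθ : θ ∈ vertexH2 K i) : aeval (pullEndo K x).toLinearMap Q θ ∈ vertexH2 K i := by
  induction Q using Polynomial.induction_on' with
  | add p q hp hq => rw [map_add, LinearMap.add_apply]; exact Submodule.add_mem _ hp hq
  | monomial n c =>
    rw [aeval_monomial, Module.End.mul_apply, Module.algebraMap_end_apply]
    refine Submodule.smul_mem _ _ ?_
    induction n with
    | zero => simpa using hθ
    | succ n ih =>
      rw [pow_succ', Module.End.mul_apply, AlgHom.toLinearMap_apply]
      exact pullEndo_mem_vertexH2 K x i ih


/-! ### The complex side: the vertex lines `ι(single i w)`, the plane generators and the spanning lemmas -/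

/-- `ι(single i w) ∈ H^*(B, ℂ)` for `w ∈ K ⊗ ℂ` (the `i`-th vertex). -/
noncomputable def gen1C (i : Fin 4) (w : KC K) : HBC K :=
  ExteriorAlgebra.ι ℂ (LinearMap.single ℂ (fun _ => KC K) i w)

/-- The ℂ-linear map `w ↦ ι(single i w)`. -/
noncomputable def gen1CL (i : Fin 4) : KC K →ₗ[ℂ] HBC K :=
  (ExteriorAlgebra.ι ℂ) ∘ₗ LinearMap.single ℂ (fun _ => KC K) i

/-- `gen1CL i w = gen1C i w`. -/
theorem gen1CL_apply (i : Fin 4) (w : KC K) : gen1CL K i w = gen1C K i w := rfl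

/-- The complexification of a vertex generator: `extC (ι(single i a)) = ι(single i (1 ⊗ a))`. -/
theorem extC_gen1 (i : Fin 4) (a : K) :
    extC K (gen1 K i a) = gen1C K i (Algebra.TensorProduct.includeRight a) := by
  rw [gen1, extC_ι, gen1C]
  congr 1
  ext j
  simp [h1ToC, LinearMap.single_apply, Pi.single_apply]
  split_ifs <;> simp

/-- `gen1C i w ∈ eigenLine K i σ` for `w ∈ eigenLineK K σ` (in `H¹(B, ℂ)`). -/
theorem single_mem_eigenLine (i : Fin 4) {σ : K →+* ℂ} {w : KC K} (hw : w ∈ eigenLineK K σ) :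
    LinearMap.single ℂ (fun _ => KC K) i w ∈ eigenLine K i σ :=
  Submodule.mem_map_of_mem hw

section family

variable {ι : Type*} (e : ι → KC K)

/-- The ℂ-span of the vertex generators `ι(single i (e g))` attached to a family `e` of vectors of `K ⊗ ℂ`
(the eigenline generators, in the application). -/
noncomputable def LiC (i : Fin 4) : Submodule ℂ (HBC K) :=
  Submodule.span ℂ (Set.range fun g => gen1C K i (e g))

/-- The ℂ-span of the products of two vertex generators: `H²(A_i, ℂ)` when `e` spans `K ⊗ ℂ`. -/
noncomputable def PiC (i : Fin 4) : Submodule ℂ (HBC K) := LiC K e i * LiC K e i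

/-- The plane generator `E_{g,g'} := ι(single i (e g)) * ι(single i (e g'))` (TIER4 A0.6: `ℓ_{i,σ} ∧ ℓ_{i,σ'}`). -/
noncomputable def planeGen (i : Fin 4) (p : ι × ι) : HBC K :=
  gen1C K i (e p.1) * gen1C K i (e p.2)

/-- `LiC` is the image of the ℂ-span of the family under `w ↦ ι(single i w)`. -/
theorem LiC_eq_map (i : Fin 4) :
    LiC K e i = (Submodule.span ℂ (Set.range e)).map (gen1CL K i) := by
  rw [LiC, Submodule.map_span, ← Set.range_comp]
  rfl

/-- If `e` spans `K ⊗ ℂ`, every vertex generator lies in `LiC`. -/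
theorem gen1C_mem_LiC (hspan : Submodule.span ℂ (Set.range e) = ⊤) (i : Fin 4) (w : KC K) :
    gen1C K i w ∈ LiC K e i := by
  rw [LiC_eq_map, hspan, Submodule.map_top]
  exact ⟨w, rfl⟩

/-- `extC` maps `H²(A_i, ℚ)` into `H²(A_i, ℂ) = LiC * LiC` when `e` spans `K ⊗ ℂ`. -/
theorem extC_mem_PiC (hspan : Submodule.span ℂ (Set.range e) = ⊤) (i : Fin 4) {θ : HB K}
    (hθ : θ ∈ vertexH2 K i) : extC K θ ∈ PiC K e i := by
  refine Submodule.mul_induction_on hθ ?_ ?_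
  · rintro _ ⟨a, rfl⟩ _ ⟨b, rfl⟩
    simp only [LinearMap.comp_apply]
    rw [map_mul, ← gen1, ← gen1, extC_gen1, extC_gen1]
    exact Submodule.mul_mem_mul (gen1C_mem_LiC K e hspan i _) (gen1C_mem_LiC K e hspan i _)
  · intro x y hx hy
    rw [map_add]
    exact Submodule.add_mem _ hx hy

/-- `H²(A_i, ℂ)` is spanned by the plane generators. -/
theorem PiC_eq_span (i : Fin 4) : PiC K e i = Submodule.span ℂ (Set.range (planeGen K e i)) := by
  rw [PiC, LiC, Submodule.span_mul_span]
  apply le_antisymm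
  · rw [Submodule.span_le]
    rintro _ ⟨_, ⟨g, rfl⟩, _, ⟨g', rfl⟩, rfl⟩
    exact Submodule.subset_span ⟨(g, g'), rfl⟩
  · rw [Submodule.span_le]
    rintro _ ⟨p, rfl⟩
    exact Submodule.subset_span ⟨_, ⟨p.1, rfl⟩, _, ⟨p.2, rfl⟩, rfl⟩

/-- The coefficients of a complexified rational class of `H²(A_i)` in the plane generators. -/
theorem exists_coeffs [Fintype ι] (hspan : Submodule.span ℂ (Set.range e) = ⊤) (i : Fin 4) {θ : HB K}
    (hθ : θ ∈ vertexH2 K i) : ∃ a : ι × ι → ℂ, ∑ p, a p • planeGen K e i p = extC K θ := by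
  have h := extC_mem_PiC K e hspan i hθ
  rw [PiC_eq_span] at h
  exact (Submodule.mem_span_range_iff_exists_fun ℂ).mp h

end family

end Summit.Ventures.HodgeRepro2.T6.A2Theta
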